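import Mathlib
import HarnessLib
import Literature.Analysis.FluidPDE.ClassicalLocalEnergyNoJump
import Literature.Analysis.FluidPDE.JiaSverak2013AprioriEstimateProofs
import Literature.Analysis.FluidPDE.ClassicalEarlyWindowBound
import Summits.NavierStokesRegularity.NavierStokesRegularity.Theorems.QuarterLogPincerTypeIQuantSubcubicExpPressureSlice

/-!
# Crux `QuarterLogPincer.TypeIQuantSubcubicExp` (stmt-NavierStokesRegularity-24077), line `thin_cascade`:
  the flux of the local energy identity on a time slice is LINEAR in the uniformly local energy under
  a pointwise velocity bound

Helper file (`--supports stmt-NavierStokesRegularity-24077 --as helper`, lead prover ns-tc-p1 g3) toward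
the registered 4th stub `stub_uniformScaledEnergy : UniformScaledEnergy` (skeleton v5).  For a classical
solution `(u, p)` of the unforced Navier–Stokes system (`ν = 1`) on an open time set `S` and a time
`t ∈ S` at which the slice `u(t)` is in `L²`, bounded pointwise by `m ≥ 0`, with unit-ball energies
`∫_{B(z,1)} |u(t)|² ≤ A` for all `z`, and at which the pressure is normalised
(`p(t) = Π[u(t)] + C` a.e., Tao's Lemma 4.1 (i)), the flux of the local energy identity tested with the
lattice cut-offs `φ_y = θ_{2,3}(y − ·)` of the tree's Jia–Šverák file obeys

  `∫ (Δφ_y |u|² + Dφ_y(u)|u|² + 2 p Dφ_y(u)) ≤ (a₁ + a₂ m) · A`            (`flux_le`)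

with universal `a₁, a₂` (Laplacian term `≤ C_Δ N₆ A`; cubic term `≤ C_g m N₆ A`; pressure term by the
slice pressure bound `exists_slice_pressure_bounds` of `…PressureSlice`, `≤ 2 C_g K m A`).  This is the
slice-level statement that the Type-I rate LINEARISES the local energy inequality.  Also: the cut-off
energy dominates unit-ball energies
(`lintegral_ball_le_ofReal_cutoffEnergy`) and is dominated by `m² |B₃|` (`cutoffEnergy_le`).

HONEST FRAMING: slice-level bookkeeping serving one registered stub of an open crux; nothing about
Navier–Stokes regularity is proved; no summit statement is proved by this file.
-/

noncomputable section

-- the summit-side namespace `Summit.NavierStokesRegularity.NavierStokesRegularity.…` (single-conjunct summit,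
-- D-0017) repeats a component by design; the dupNamespace linter would flag every declaration.
set_option linter.dupNamespace false

namespace Summit.NavierStokesRegularity.NavierStokesRegularity.Theorems.ThinCascade

open MeasureTheory Set Function Metric Filter Topology
open scoped ENNReal NNReal ContDiff Laplacian
open Literature.Analysis Literature.Analysis.FluidPDE Literature.Analysis.FluidPDE.JiaSverak2013

/-! ### The lattice cut-offs as test functions -/

/-- `φ_y = θ_{2,3}(y − ·)` is smooth (all orders). [folklore] -/
theorem contDiff_cutoff_infty (y : EuclideanSpace ℝ (Fin 3)) :
    ContDiff ℝ ∞ (fun w => radialCutoff 2 3 (y - w)) :=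
  contDiff_testFn y

/-- `φ_y` has compact support (inside `B̄(y,3)`). [folklore] -/
theorem hasCompactSupport_cutoff (y : EuclideanSpace ℝ (Fin 3)) :
    HasCompactSupport (fun w => radialCutoff 2 3 (y - w)) :=
  (isCompact_closedBall y 3).of_isClosed_subset (isClosed_tsupport _) (tsupport_testFn_subset y)

/-- Off `B̄(y,3)` the Fréchet derivative of `φ_y` vanishes. [folklore] -/
theorem fderiv_cutoff_eq_zero {y x : EuclideanSpace ℝ (Fin 3)} (hx : x ∉ closedBall y 3) :
    fderiv ℝ (fun w => radialCutoff 2 3 (y - w)) x = 0 :=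
  fderiv_of_notMem_tsupport ℝ fun h => hx (tsupport_testFn_subset y h)

/-- `‖Dφ_y(x)‖ = ‖∇φ_y(x)‖`. [folklore] -/
theorem norm_fderiv_cutoff_eq (y x : EuclideanSpace ℝ (Fin 3)) :
    ‖fderiv ℝ (fun w => radialCutoff 2 3 (y - w)) x‖ =
      ‖gradient (fun w => radialCutoff 2 3 (y - w)) x‖ := by
  rw [gradient]
  exact ((InnerProductSpace.toDual ℝ (EuclideanSpace ℝ (Fin 3))).symm.norm_map _).symm

/-! ### Closed balls -/

/-- Closed and open balls carry the same lower integrals (spheres are Lebesgue-null). [folklore] -/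
theorem setLIntegral_closedBall_eq_ball (y : EuclideanSpace ℝ (Fin 3)) (r : ℝ)
    (f : EuclideanSpace ℝ (Fin 3) → ℝ≥0∞) :
    ∫⁻ x in closedBall y r, f x = ∫⁻ x in ball y r, f x := by
  refine setLIntegral_congr ?_
  refine (ae_eq_set).2 ⟨?_, ?_⟩
  · rw [Metric.closedBall_sdiff_ball]
    exact Measure.addHaar_sphere volume y r
  · rw [sdiff_eq_empty.2 ball_subset_closedBall]
    exact measure_empty

/-! ### The cut-off energy of a slice -/

/-- **Unit-ball energies are dominated by the cut-off energies at the lattice**: if `dist z y < 1`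
then `∫_{B(z,1)} |w|² ≤ ∫ φ_y |w|²` (as `ofReal` of the real integral, `w` continuous). [folklore] -/
theorem lintegral_ball_le_ofReal_cutoffEnergy {w : EuclideanSpace ℝ (Fin 3) → EuclideanSpace ℝ (Fin 3)}
    (hw : Continuous w) {z y : EuclideanSpace ℝ (Fin 3)} (h : dist z y < 1) :
    ∫⁻ x in ball z 1, ‖w x‖ₑ ^ 2 ≤
      ENNReal.ofReal (∫ x, radialCutoff 2 3 (y - x) * ‖w x‖ ^ 2) := by
  have hint : Integrable (fun x => radialCutoff 2 3 (y - x) * ‖w x‖ ^ 2) :=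
    ((contDiff_cutoff_infty y).continuous.mul (hw.norm.pow 2)).integrable_of_hasCompactSupport
      ((hasCompactSupport_cutoff y).mul_right)
  rw [ofReal_integral_eq_lintegral_ofReal hint (ae_of_all _ fun x =>
    mul_nonneg (testFn_nonneg y x) (sq_nonneg _))]
  calc ∫⁻ x in ball z 1, ‖w x‖ₑ ^ 2
      ≤ ∫⁻ x, ‖w x‖ₑ ^ 2 * ENNReal.ofReal (radialCutoff 2 3 (y - x)) :=
        lintegral_ball_le_lintegral_mul_cutoff h
    _ = ∫⁻ x, ENNReal.ofReal (radialCutoff 2 3 (y - x) * ‖w x‖ ^ 2) := by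
        refine lintegral_congr fun x => ?_
        rw [ENNReal.ofReal_mul (testFn_nonneg y x), ENNReal.ofReal_pow (norm_nonneg _), ofReal_norm,
          mul_comm]

/-- **The cut-off energy under a pointwise bound**: `∫ φ_y |w|² ≤ m² |B₃|`. [folklore] -/
theorem cutoffEnergy_le {w : EuclideanSpace ℝ (Fin 3) → EuclideanSpace ℝ (Fin 3)} (hw : Continuous w)
    {m : ℝ} (hwm : ∀ x, ‖w x‖ ≤ m) (y : EuclideanSpace ℝ (Fin 3)) :
    ∫ x, radialCutoff 2 3 (y - x) * ‖w x‖ ^ 2 ≤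
      m ^ 2 * (volume (ball (0 : EuclideanSpace ℝ (Fin 3)) 3)).toReal := by
  have hm0 : 0 ≤ m := (norm_nonneg _).trans (hwm 0)
  have h0 : ∀ x, x ∉ closedBall y 3 → radialCutoff 2 3 (y - x) * ‖w x‖ ^ 2 = 0 := fun x hx => by
    rw [image_eq_zero_of_notMem_tsupport (fun h => hx (tsupport_testFn_subset y h)), zero_mul]
  rw [← setIntegral_eq_integral_of_forall_compl_eq_zero h0]
  have hvol : (volume (closedBall y 3)).toReal = (volume (ball (0 : EuclideanSpace ℝ (Fin 3)) 3)).toReal := by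
    rw [Measure.addHaar_closedBall_eq_addHaar_ball, Measure.addHaar_ball_center]
  calc ∫ x in closedBall y 3, radialCutoff 2 3 (y - x) * ‖w x‖ ^ 2
      ≤ ∫ x in closedBall y 3, m ^ 2 := by
        refine setIntegral_mono_on ?_ (integrableOn_const (by
          rw [Measure.addHaar_closedBall_eq_addHaar_ball]; exact measure_ball_lt_top.ne))
          measurableSet_closedBall fun x _ => ?_
        · exact (((contDiff_cutoff_infty y).continuous.mul (hw.norm.pow 2)).integrable_of_hasCompactSupport
            ((hasCompactSupport_cutoff y).mul_right)).integrableOn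
        · calc radialCutoff 2 3 (y - x) * ‖w x‖ ^ 2 ≤ 1 * ‖w x‖ ^ 2 :=
              mul_le_mul_of_nonneg_right (testFn_le_one y x) (sq_nonneg _)
            _ ≤ m ^ 2 := by
                rw [one_mul]
                exact pow_le_pow_left₀ (norm_nonneg _) (hwm x) 2
    _ = m ^ 2 * (volume (ball (0 : EuclideanSpace ℝ (Fin 3)) 3)).toReal := by
        rw [setIntegral_const, smul_eq_mul, mul_comm, Measure.real, hvol]

/-! ### Real integrals from lower integrals -/

/-- For a nonnegative integrable `f` and a measurable set, `∫_s f = (∫⁻_s ofReal f).toReal`, hence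
`∫_s f ≤ B.toReal` whenever `∫⁻_s ofReal f ≤ B ≠ ⊤`. [folklore] -/
theorem setIntegral_le_toReal_of_lintegral_le {f : EuclideanSpace ℝ (Fin 3) → ℝ}
    {s : Set (EuclideanSpace ℝ (Fin 3))} (hf : IntegrableOn f s volume) (hf0 : ∀ x, 0 ≤ f x)
    {B : ℝ≥0∞} (hB : B ≠ ⊤) (h : ∫⁻ x in s, ENNReal.ofReal (f x) ≤ B) :
    ∫ x in s, f x ≤ B.toReal := by
  rw [integral_eq_lintegral_of_nonneg_ae (ae_of_all _ hf0) hf.aestronglyMeasurable]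
  exact ENNReal.toReal_mono hB h

/-! ### The flux bound on a slice -/

/-- **The flux of the local energy identity is linear in the uniformly local energy under a
pointwise bound.**  There are universal `a₁, a₂ ≥ 0` such that: for a classical solution `(u, p)` of
the unforced Navier–Stokes system with `ν = 1` on an open time set `S`, a time `t ∈ S` at which
`u(t) ∈ L²`, `‖u(t, ·)‖ ≤ m` pointwise, `p(t) = Π[u(t)] + C` a.e. for some constant `C`, and the
unit-ball energies satisfy `∫_{B(z,1)} |u(t)|² ≤ A < ∞` for every centre `z`, the flux tested with any
lattice cut-off `φ_y = θ_{2,3}(y − ·)` satisfies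
`∫ (Δφ_y |u|² + Dφ_y(u)|u|² + 2 p Dφ_y(u)) ≤ (a₁ + a₂ m) · A`.
(Laplacian term: `|Δφ_y| ≤ C_Δ` on `B̄(y,3)`, covering; cubic term: `|u|³ ≤ m|u|²`; pressure term:
gauge freedom `integral_flux_le` with the gauge of `exists_slice_pressure_bounds`.) [folklore] -/
theorem exists_flux_le :
    ∃ a₁ a₂ : ℝ, 0 ≤ a₁ ∧ 0 ≤ a₂ ∧
      ∀ {S : Set ℝ} {u : ℝ → EuclideanSpace ℝ (Fin 3) → EuclideanSpace ℝ (Fin 3)}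
        {p : ℝ → EuclideanSpace ℝ (Fin 3) → ℝ},
        IsClassicalNSSolutionOn S 1 0 u p → ∀ {t : ℝ}, t ∈ S →
        MemLp (u t) 2 volume → ∀ {m : ℝ}, (∀ x, ‖u t x‖ ≤ m) →
        (∃ C : ℝ, ∀ᵐ x ∂(volume : Measure (EuclideanSpace ℝ (Fin 3))),
          p t x = rieszPressure (u t) x + C) →
        ∀ {A : ℝ≥0∞}, A ≠ ⊤ →
        (∀ z : EuclideanSpace ℝ (Fin 3), ∫⁻ x in ball z 1, ‖u t x‖ₑ ^ 2 ≤ A) →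
        ∀ y : EuclideanSpace ℝ (Fin 3),
          ∫ x, ((1 : ℝ) * ((Δ (fun w => radialCutoff 2 3 (y - w))) x * ‖u t x‖ ^ 2) +
              fderiv ℝ (fun w => radialCutoff 2 3 (y - w)) x (u t x) * ‖u t x‖ ^ 2 +
              2 * (p t x * fderiv ℝ (fun w => radialCutoff 2 3 (y - w)) x (u t x))) ≤
            (a₁ + a₂ * m) * A.toReal := by
  obtain ⟨CΔ, Cg, hCΔ0, hCg0, hCΔ, hCg⟩ := exists_testFn_bounds
  obtain ⟨N₆, hN₆top, hN₆⟩ := exists_lintegral_ball_six_le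
  obtain ⟨K, hKtop, hK⟩ := exists_slice_pressure_bounds
  refine ⟨CΔ * N₆.toReal, Cg * N₆.toReal + 2 * Cg * K.toReal, by positivity, by positivity, ?_⟩
  intro S u p hcl t ht h2 m hum hp A hAtop hA y
  set φ : EuclideanSpace ℝ (Fin 3) → ℝ := fun w => radialCutoff 2 3 (y - w) with hφ
  set w : EuclideanSpace ℝ (Fin 3) → EuclideanSpace ℝ (Fin 3) := u t with hw
  have hm0 : 0 ≤ m := (norm_nonneg _).trans (hum 0)
  have hwc : Continuous w := (hcl.contDiff_velocity ht).continuous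
  have hpc : Continuous (p t) := (hcl.contDiff_pressure ht).continuous
  have hw3 : MemLp w 3 volume := memLp_three_of_memLp_two_of_norm_le h2 hum
  -- the gauge
  obtain ⟨C, hC⟩ := hp
  obtain ⟨κ, hκ1, -⟩ := hK w hw3 m hm0 hum A hA y
  -- the gauged flux bound of the tree
  have hflux := hcl.integral_flux_le (contDiff_cutoff_infty y) (hasCompactSupport_cutoff y) ht (C + κ)
  rw [abs_one, one_mul] at hflux
  -- sizes of the three terms
  -- (1) `∫ |Δφ| |w|² ≤ CΔ ∫_{B̄(y,3)} |w|² ≤ CΔ N₆ A`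
  have hB3 : ∫⁻ x in closedBall y 3, ‖w x‖ₑ ^ 2 ≤ N₆ * A := by
    rw [setLIntegral_closedBall_eq_ball]
    exact (lintegral_mono_set (ball_subset_ball (by norm_num))).trans (hN₆ _ A hA y)
  have hNAtop : N₆ * A ≠ ⊤ := ENNReal.mul_ne_top hN₆top hAtop
  have hsq_int : IntegrableOn (fun x => ‖w x‖ ^ 2) (closedBall y 3) volume :=
    (hwc.norm.pow 2).continuousOn.integrableOn_compact (isCompact_closedBall y 3)
  have hsq : ∫ x in closedBall y 3, ‖w x‖ ^ 2 ≤ (N₆ * A).toReal := by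
    refine setIntegral_le_toReal_of_lintegral_le hsq_int (fun x => sq_nonneg _) hNAtop ?_
    refine le_of_eq_of_le (lintegral_congr fun x => ?_) hB3
    rw [ENNReal.ofReal_pow (norm_nonneg _), ofReal_norm]
  have h1 : ∫ x, |(Δ φ) x| * ‖w x‖ ^ 2 ≤ CΔ * (N₆ * A).toReal := by
    have h0 : ∀ x, x ∉ closedBall y 3 → |(Δ φ) x| * ‖w x‖ ^ 2 = 0 := fun x hx => by
      rw [hφ, laplacian_testFn_eq_zero hx, abs_zero, zero_mul]
    rw [← setIntegral_eq_integral_of_forall_compl_eq_zero h0]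
    calc ∫ x in closedBall y 3, |(Δ φ) x| * ‖w x‖ ^ 2
        ≤ ∫ x in closedBall y 3, CΔ * ‖w x‖ ^ 2 := by
          refine setIntegral_mono_on ?_ (hsq_int.const_mul _) measurableSet_closedBall
            fun x _ => mul_le_mul_of_nonneg_right (hCΔ y x) (sq_nonneg _)
          have hc : Continuous fun x => |(Δ φ) x| * ‖w x‖ ^ 2 :=
            (continuous_abs.comp (continuous_laplacian ((contDiff_cutoff_infty y).of_le
              (by norm_cast)))).mul (hwc.norm.pow 2)
          exact hc.continuousOn.integrableOn_compact (isCompact_closedBall y 3)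
      _ = CΔ * ∫ x in closedBall y 3, ‖w x‖ ^ 2 := integral_const_mul _ _
      _ ≤ CΔ * (N₆ * A).toReal := mul_le_mul_of_nonneg_left hsq hCΔ0
  -- (2) `∫ ‖Dφ‖ |w|³ ≤ Cg m ∫_{B̄(y,3)} |w|² ≤ Cg m N₆ A`
  have h2' : ∫ x, ‖fderiv ℝ φ x‖ * ‖w x‖ ^ 3 ≤ Cg * m * (N₆ * A).toReal := by
    have h0 : ∀ x, x ∉ closedBall y 3 → ‖fderiv ℝ φ x‖ * ‖w x‖ ^ 3 = 0 := fun x hx => by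
      rw [hφ, fderiv_cutoff_eq_zero hx, norm_zero, zero_mul]
    rw [← setIntegral_eq_integral_of_forall_compl_eq_zero h0]
    calc ∫ x in closedBall y 3, ‖fderiv ℝ φ x‖ * ‖w x‖ ^ 3
        ≤ ∫ x in closedBall y 3, Cg * m * ‖w x‖ ^ 2 := by
          refine setIntegral_mono_on ?_ (hsq_int.const_mul _) measurableSet_closedBall
            fun x _ => ?_
          · have hc : Continuous fun x => ‖fderiv ℝ φ x‖ * ‖w x‖ ^ 3 :=
              (((contDiff_cutoff_infty y).continuous_fderiv (by norm_cast)).norm).mul (hwc.norm.pow 3)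
            exact hc.continuousOn.integrableOn_compact (isCompact_closedBall y 3)
          · have hD : ‖fderiv ℝ φ x‖ ≤ Cg := by rw [hφ, norm_fderiv_cutoff_eq]; exact hCg y x
            calc ‖fderiv ℝ φ x‖ * ‖w x‖ ^ 3 = ‖fderiv ℝ φ x‖ * (‖w x‖ * ‖w x‖ ^ 2) := by ring
              _ ≤ Cg * (m * ‖w x‖ ^ 2) := mul_le_mul hD (mul_le_mul_of_nonneg_right (hum x)
                  (sq_nonneg _)) (by positivity) hCg0
              _ = Cg * m * ‖w x‖ ^ 2 := by ring
      _ = Cg * m * ∫ x in closedBall y 3, ‖w x‖ ^ 2 := integral_const_mul _ _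
      _ ≤ Cg * m * (N₆ * A).toReal := mul_le_mul_of_nonneg_left hsq (by positivity)
  -- (3) `∫ |p - (C + κ)| ‖Dφ‖ |w| ≤ Cg ∫_{B(y,3)} |Π[w] - κ| |w| ≤ Cg K m A`
  have hKAtop : K * ENNReal.ofReal m * A ≠ ⊤ :=
    ENNReal.mul_ne_top (ENNReal.mul_ne_top hKtop ENNReal.ofReal_ne_top) hAtop
  have h3 : ∫ x, |p t x - (C + κ)| * ‖fderiv ℝ φ x‖ * ‖w x‖ ≤
      Cg * (K * ENNReal.ofReal m * A).toReal := by
    -- the integrand is continuous with compact support, hence integrable, and nonnegative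
    have hc : Continuous fun x => |p t x - (C + κ)| * ‖fderiv ℝ φ x‖ * ‖w x‖ :=
      ((continuous_abs.comp (hpc.sub continuous_const)).mul
        ((contDiff_cutoff_infty y).continuous_fderiv (by norm_cast)).norm).mul hwc.norm
    have h0 : ∀ x, x ∉ closedBall y 3 → |p t x - (C + κ)| * ‖fderiv ℝ φ x‖ * ‖w x‖ = 0 :=
      fun x hx => by rw [hφ, fderiv_cutoff_eq_zero hx, norm_zero, mul_zero, zero_mul]
    have hint : Integrable (fun x => |p t x - (C + κ)| * ‖fderiv ℝ φ x‖ * ‖w x‖) :=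
      hc.integrable_of_hasCompactSupport (HasCompactSupport.intro (isCompact_closedBall y 3) h0)
    rw [integral_eq_lintegral_of_nonneg_ae (ae_of_all _ fun x => by positivity)
      hint.aestronglyMeasurable]
    have hCgK : Cg * (K * ENNReal.ofReal m * A).toReal =
        (ENNReal.ofReal Cg * (K * ENNReal.ofReal m * A)).toReal := by
      simp only [ENNReal.toReal_mul, ENNReal.toReal_ofReal hCg0]
    rw [hCgK]
    refine ENNReal.toReal_mono (ENNReal.mul_ne_top ENNReal.ofReal_ne_top hKAtop) ?_
    -- pass to `B̄(y,3)`, replace `p` by `Π[w] + C`, bound `‖Dφ‖ ≤ Cg`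
    calc ∫⁻ x, ENNReal.ofReal (|p t x - (C + κ)| * ‖fderiv ℝ φ x‖ * ‖w x‖)
        = ∫⁻ x in closedBall y 3, ENNReal.ofReal (|p t x - (C + κ)| * ‖fderiv ℝ φ x‖ * ‖w x‖) := by
          refine (setLIntegral_eq_of_support_subset fun x hx => ?_).symm
          by_contra hxB
          exact hx (show ENNReal.ofReal (|p t x - (C + κ)| * ‖fderiv ℝ φ x‖ * ‖w x‖) = 0 by
            rw [h0 x hxB, ENNReal.ofReal_zero])
      _ ≤ ∫⁻ x in closedBall y 3, ENNReal.ofReal Cg * (‖rieszPressure w x - κ‖ₑ * ‖w x‖ₑ) := by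
          refine lintegral_mono_ae ?_
          filter_upwards [ae_restrict_of_ae (s := closedBall y 3) hC] with x hx
          have hD : ‖fderiv ℝ φ x‖ ≤ Cg := by rw [hφ, norm_fderiv_cutoff_eq]; exact hCg y x
          rw [hx, show rieszPressure w x + C - (C + κ) = rieszPressure w x - κ by ring,
            ENNReal.ofReal_mul (by positivity), ENNReal.ofReal_mul (abs_nonneg _), ofReal_norm,
            ofReal_norm, ← Real.enorm_eq_ofReal_abs]
          have hD' : ‖fderiv ℝ φ x‖ₑ ≤ ENNReal.ofReal Cg := by
            rw [← ofReal_norm]; exact ENNReal.ofReal_le_ofReal hD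
          calc ‖rieszPressure w x - κ‖ₑ * ‖fderiv ℝ φ x‖ₑ * ‖w x‖ₑ
              ≤ ‖rieszPressure w x - κ‖ₑ * ENNReal.ofReal Cg * ‖w x‖ₑ := by
                gcongr
            _ = ENNReal.ofReal Cg * (‖rieszPressure w x - κ‖ₑ * ‖w x‖ₑ) := by ring
      _ = ENNReal.ofReal Cg * ∫⁻ x in ball y 3, ‖rieszPressure w x - κ‖ₑ * ‖w x‖ₑ := by
          rw [lintegral_const_mul' _ _ ENNReal.ofReal_ne_top, setLIntegral_closedBall_eq_ball]
      _ ≤ ENNReal.ofReal Cg * (K * ENNReal.ofReal m * A) := mul_le_mul' le_rfl hκ1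
  -- assemble
  have eNA : (N₆ * A).toReal = N₆.toReal * A.toReal := ENNReal.toReal_mul
  have eKA : (K * ENNReal.ofReal m * A).toReal = K.toReal * m * A.toReal := by
    rw [ENNReal.toReal_mul, ENNReal.toReal_mul, ENNReal.toReal_ofReal hm0]
  rw [eNA] at h1 h2'
  rw [eKA] at h3
  calc _ ≤ (∫ x, |(Δ φ) x| * ‖w x‖ ^ 2) + (∫ x, ‖fderiv ℝ φ x‖ * ‖w x‖ ^ 3) +
        2 * ∫ x, |p t x - (C + κ)| * ‖fderiv ℝ φ x‖ * ‖w x‖ := hflux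
    _ ≤ CΔ * (N₆.toReal * A.toReal) + Cg * m * (N₆.toReal * A.toReal) +
        2 * (Cg * (K.toReal * m * A.toReal)) := by
          gcongr
    _ = (CΔ * N₆.toReal + (Cg * N₆.toReal + 2 * Cg * K.toReal) * m) * A.toReal := by ring

end Summit.NavierStokesRegularity.NavierStokesRegularity.Theorems.ThinCascade

end
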